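import Literature.Analysis.FluidPDE.Tao2016AveragedNS.GateRetuning
import HarnessLib

/-!
# Tao 2016, §6: the hand-off audit — which checkpoint constants the blowup induction CONSUMES

HONEST FRAMING (cell `pub-fluidc`, blueprint seat bp1, generation 11): a low prior, high
value-of-information experiment on Tao's machine paradigm; NOT a claim that NS blows up. This file is
DESIGN ARITHMETIC: a ledger pointing into the tree's kernel-checked formalisation of Tao's §6
(`TaoCascade*.lean`, K ≥ 10¹⁸) plus five caricature-level scaling laws, each a short theorem about a
scalar linear ODE. It does NOT re-run the §6 induction with other constants (that is successor work:
`blowupDynamicsStepWith γ` with `(γ, 10⁻⁵, K¹⁰) ↦ (γ', h', M')`).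

## 0. The question (DIVERGENCE.md D17 (d)(i), gen-10 successor list item 2)

Tao's Proposition 6.3 (`TaoCascade.blowupDynamics`, checkpoint form `BlowupCheckpointsWith γ`) hands
scale `n` to scale `n+1` at the checkpoint time `t_n` with the state bounds (viii)
(`TaoCascade.StateBoundsWith`, tree numbering (6.15)–(6.20); arXiv v3 numbers are two higher):
clock pre-load `|b_n(t_n)| ≤ 10⁻⁵ ε e_n` (`x2_abs_le`), trigger pre-load `|c_n(t_n)| ≤ γ ε² e_n`,
`γ = 10⁻⁵e^{-K¹⁰/2}` after the erratum (`x3_abs_le`, `TaoBlog2014AveragedNSErratum`), conduit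
`|d_n(t_n)| ≤ K⁻¹⁰ e_n` (`x4_abs_le`), residual `E_{n-1}(t_n) ≤ K⁻²⁰ e_n²` (`energy_prev_le`), and the
step bounds (ix) (`StepBounds`): lifespan `(t_n - t_{n-1})(1+ε₀)^{5(n-1)/2} ∈ [10⁻², 10⁴]`, old clock
`b_{n-1}(t_n) ∈ [10⁻², 10⁵]·ε e`, old trigger `c_{n-1}(t_n) ∈ [e^{K⁹}, e^{K¹⁰}]·ε² e`. Gens 5–10 of this
seat and bp3's `FluidComputer/ThresholdGate.lean` showed that Theorem 5.3's gate is adversarially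
fragile at radius `≈ seed = θe^{-K¹⁰}` and that the fragility is a property of ARMING DEPTH. The audit
asks: which of these exponentials does the INDUCTION consume, and as what inequality?

## 1. The ledger (produced → consumed, with the tree decl where the consumption is kernel-checked)

All decls below live in `Literature.Analysis.FluidPDE.TaoCascade*`; `ZeroScale.Setting.*` is the
rescaled step of §6.5–6.7 (scale `n ↦ 0`, amplitude `e_n ↦ 1`).

* (L1) CLOCK PRE-LOAD `h := |b₀(0)|/ε ≤ 10⁻⁵`. Consumed (a) in (6.147)/(6.148)
  `ZeroScale.Setting.abs_c_zero_le`: `|c₀(t)| ≤ 10⁻⁴ε²·exp(K¹⁰·t·(10⁻⁵ + t + K⁻⁷) - K¹⁰/2)`, whence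
  `smallC_of_le_half` (`t_c ≥ 1/2`) needs only `½(h + ½ + K⁻⁷)K¹⁰ - K¹⁰/2 ≤ -10K`, true for every
  `h < 1/2 - O(K⁻⁷)` (`Handoff.tc_half_exponent_room`); (b) in (6.157) `b_zero_ge`:
  `b₀(t) ≥ (t - 10⁻⁵ - K⁻⁸)ε`, whence `b₀(t_c) ≥ 0.49ε` (`TaoCascadeZeroScaleTauOne`, rotor-phase
  amplification rate `≥ 0.48K¹⁰`) and the ignition lower bound `c_zero_lower`
  (`exp((t²/2 - 10⁻⁵t - 1 + O(K⁻⁹))K¹⁰)ε²`) giving `tc_lt_two`, which needs `2²/2 - 2h - 1 > 0`, i.e.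
  `h < 1/2` (`Handoff.tc_two_room`); (c) the floor `t_c ≥ 1/2` itself is consumed a third time in
  Prop. 6.17 (`F_negOne_le_rotor_phase`): `∫₀^{t_c} a₀ ≳ 1` is the PRE-DECAY time of the old residual
  (see (L5)). SLACK: stated `10⁻⁵`, tolerated `≈ 0.49`. LAW: a clock head start `h` advances a swept
  trigger's ignition by AT MOST `h` (`Handoff.ignitionTimeH_le`, `Handoff.sub_le_ignitionTimeH`) — the
  clock channel is O(1)-robust in timing at every `M`.
* (L2) TRIGGER PRE-LOAD `γ = 10⁻⁵e^{-K¹⁰/2}`. Consumed (a) at `t = 0` by `smallC_zero` only as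
  `γ ≤ K⁻¹⁰` (via `exp(-K¹⁰/2) ≤ K⁻¹⁰⁰`); (b) as the initial value in (6.148) above: `t_c ≥ 1/2` needs
  `10γ'·exp(K¹⁰·½(h + ½ + K⁻⁷)) ≤ K⁻¹⁰` where `γ = γ'e^{-K¹⁰/2}`-type, i.e. a tolerance
  `θ·exp(-M·t_min(h + t_min))` with `θ = K⁻¹⁰/10`, `M = K¹⁰`, `t_min = 1/2` (the tree uses the crude
  `t_min²`; the sharp caricature value is `t_min²/2`, `Handoff.preload_lt_threshold`,
  `Handoff.sweptTriggerH_fires_of_ge`: the tolerance is EXACTLY `θe^{-M(t_min²/2 + h t_min)}`). It is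
  exponentially small ONLY because the amplifier rate `M = K¹⁰` multiplies the O(1) floor `t_min = 1/2`
  (`Handoff.tolerance_tao_le`); with `M(t_min²/2 + h t_min) ≤ p·log K` it is `≥ θK⁻ᵖ`
  (`Handoff.tolerance_ge_of_le_log`).
* (L3) CONDUIT `|d₀(0)| ≤ K⁻¹⁰`. Consumed polynomially: `sqrt_da_le` (`d₀, a₁ = O(K⁻¹⁰)` while
  `|c₀| ≤ K⁻¹⁰ε²`), `integral_a_one_sq_le` (`∫a₁² ≤ 4.9·10⁵K⁻²⁰t`, no premature forward flow). No law
  needed: polynomial in, polynomial out.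
* (L4) RESIDUAL `Ẽ₋₁(0) ≤ K⁻²⁰`. Produced by the drain (`TaoCascadeZeroScaleDrainFinal`:
  `Ẽ₀(t) ≲ exp(-K∫a₁) + K⁻²⁸`, `a₁ ≥ 0.05` on `[t_c + 1/K, t_c + K^{-1/2}]`, so `0.05K·K^{-1/2} ≥ 28 log K`
  — the reason for the tree's `K ≥ 10¹⁸`). Consumed only as `≲ K⁻¹⁰`: `F_negOne_le_tc`,
  `F_negOne_lt_exit` (no coarse exit before `t_c`), Prop. 6.17's starting value, Lemma 6.8 (`m = 2`).
  SLACK `K¹⁰`. LAW: the drain is two-sided — residual `≤ r/(Kα) + E₀e^{-KαW}` needs `KαW ≳ q log K`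
  e-folds (`Handoff.drain_residual_le`) and CANNOT beat `E₀e^{-KᾱW}` (`Handoff.drain_residual_ge`):
  the window has an intrinsic floor `W ≳ q log K/(Kᾱ)`, polynomial.
* (L5) SPIN BOUNDS (ix) `c₋₁(0) ∈ [e^{K⁹}, e^{K¹⁰}]ε²`, `b₋₁(0) ∈ [10⁻², 10⁵]ε`. Produced by
  `c_zero_τone_ge` (`0.48K¹⁰·K^{-1/2}` e-folds over the rotor window) and (6.27). Consumed ONLY in
  Prop. 6.17 (`TaoCascadeZeroScaleCoarseBound/CoarseLevels/CoarseNoExit`, [Tao2016AveragedNS §6.7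
  pp. 39–40]): the old clock `b₋₁ ≥ 10⁻⁶ε` keeps amplifying, `c₋₁ ≥ exp(10⁻⁸K¹⁰)ε²` on `[1/10, τ₁]`,
  and this enters as (a) the equipartition corrector `K·ε²/c₋₁ ≤ K⁻¹⁰⁰` and (b) the SPEED MISMATCH
  `(ε²/c₋₁)·∂ₜa₀ ≤ K⁻¹⁰⁰` with `∂ₜa₀ = O(ε⁻²c₀) = O(exp(O(K^{9.5})))`: what is NEEDED is a polynomial
  lower bound on the old rotor rate and a polynomial RATIO old/new rotor rate on `[t_c, τ₁]`; the
  exponentials are what the design delivers. What 6.17 does with them: equipartition (old rotor fast)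
  turns drain AND backflow of `Ẽ₋₁` into the signed rate `-(K/2)a₀`, so the net factor over `[0, t]` is
  `exp(-(K/2)∫₀ᵗa₀)`: the backflow over the new rotor window (`|∫a₀| ≤ W = K^{-1/2}`, factor `≤ e^{√K/2}`,
  cf. the crude `Handoff.backflow_le`) is PAID FROM the pre-decay over `[0, t_c]` (`a₀ ≈ 1`, `t_c ≥ 1/2`,
  factor `e^{-K/4}`): an O(1) requirement DELAY ≫ WINDOW, plus the polynomial rotor conditions. For a
  drain-limited window `W = q log K/(Kᾱ)` even the crude bound is polynomial (`K^{q/ᾱ}`).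
* (L6) LIFESPAN `[10⁻², 10⁴]`, AMPLITUDE RATIO `(1+ε₀)^{±1/10}`: consumed by the assembly only
  (`BlowupCheckpointsWith.time_le_uniform`: finite blowup time) and `life_ge → b_prev ≥ 10⁻²ε`. O(1).
  The assembly is literally insensitive to the trigger coefficient:
  `TaoCascade.noGlobalODESolution_of_blowupDynamicsStepWith` holds for EVERY `γ ≥ 0`.
* (L7) `ε ≤ exp(-10⁶K¹⁰)` (`ZeroScale.Regime.ε_le_exp`): consumed as `ε ≤ K⁻ⁿ`, `n ≤ 10⁶`
  (`Regime.ε_le_inv_K_pow`) and to keep Tao's OWN rotor below saturation ((6.27) `c ≤ e^{K¹⁰}ε²` makes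
  the clock-drain term `K¹⁰ε⁻¹c² ≤ K¹⁰e^{2K¹⁰}ε³ ≪ ε`, `Regime.late_small`-type lemmas): `ε`'s
  hyper-exponential smallness is forced by the exponential spin-up of the design's trigger, i.e. by
  `ε ≲ (seed/threshold)²·poly(K)`, not by the induction's logic.

## 2. Reading (design level; conjectural beyond the caricature theorems below)

Every CONSUMED inequality is polynomial in `K`, and the timing requirements are O(1)-soft: the
checkpoint accepts any ignition time in `[1/2, 2]` and any lifespan in `[10⁻², 10⁴]`. The numbers
`e^{±cK¹⁰}` enter in exactly two ways: as PRODUCED values propagated consistently, and in the pre-load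
tolerances through the single factor `M = K¹⁰` multiplying O(1) times — tolerance
`θe^{-M(t_min²/2 + h·t_min)}` (§B below). Hence, at design level: polynomial pre-load tolerance ⟺
`M·t_min² = O(log K)` ⟺ (since `t_min < t_ign` and arming depth `A = M t_ign²/2`, gen 10
`sharpening_eq_two_mul_log`) POLYNOMIAL ARMING DEPTH `A = O(log K)` ⟺ polynomial seed `θK⁻ᵖ` ⟺ (gen 6
`not_firesOnBudget_of_seed_mul_le`, bp3 §2k.4: radius ≤ seed; below the seed an armed trigger is only
RE-TIMED, never stalled) POLYNOMIAL ADVERSARIAL RADIUS in the trigger channel. Theorem 5.3's window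
`t_c ± K^{-1/2}` with `t_c ≈ √2` made BY ARMING is what forces `A ≍ K¹⁰`; §6 does not ask for it.
This CORRECTS gen-10 D17(a) (the decoupled seed/amplifier family "buys nothing": under §6's soft timing
it buys exactly polynomial radius) and SHARPENS bp3 §2k.5 ("exponential fragility is a property of
arming": of arming DEPTH, which Thm 5.3's precision, not §6, sets). A polynomial redesign must still meet,
jointly inside Prop. 6.5's bootstrap — NOT verified here —: (R1) drain e-folds `KαW ≥ q log K` (§D);
(R2) loading action `Λ ≤ β·t_ign` (§C: `Λ` IS the next clock's head start); (R3) speed mismatch: old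
rotor ≥ `K^{O(1)}`× new rotor on the new rotor window, i.e. `A ≳ (q/2) log K` AND no saturation,
`ε ≲ e^{-2A}·poly`; (R4) a self-consistent after-envelope (Tao's `K⁻³⁰(1+ε₀)^{-10m}` becomes
`K^{-2A·m/log K}`-type); (R5) ignition sharpness `ρ·t_ign = 2A ≳ 1/β`. Each is polynomial.
NUMERICS (evidence file, no theorem depends on it): the chained toy cascade `kit` job j048441
(`pub-fluidc-bp1/num/handoff.py`; (6.45)–(6.48) without dissipation, 5 levels, `ε = 10⁻³`, `K = 30`;
DICTIONARY §14 (D) + ADDENDUM, predictions registered before the run): Tao-like arming (`A = M = 16, 24`)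
and shallow arming (`A = M = 5`) complete the cascade identically up to the scalings delay
`≈ √(2(A + log K)/M)`, width `W ≈ 3/ρ` with `ρ = M·t_ign` (IGNITION-limited, because `ρ < K` there —
the drain cap of `GateRetuning` §E binds only for `ρ > K`, as in Tao's `ρ = K¹⁰t`; so in a polynomial
design R5 sets the width and R2 follows: `Λ/t_ign ≤ 0.08` observed), next-clock head start `= Λ` to four
digits (§C with near-equality), pre-amplification `≤ 0.05` e-folds; additive trigger forcing from `10⁻¹⁶`
to `10⁻³` (ten decades above the seed) NEVER stalls the cascade — it re-times the level by `≈ 0.1` per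
decade above the seed — while the exact seed canceller stalls it and a `0.1%`-detuned canceller does not;
the clock channel stalls at forcing `≈ ε`. I.e. the only exponentially small quantity in the hand-off is
the seed `ε²e^{-A}` itself: the arming depth, as the READING says.

## 3. Contents (all `sorry`-free, no named facts)

* §A `tc_half_exponent_room`, `tc_two_room`: the O(1) slack in the two consumptions of `h`.
* §B head-start swept trigger `sweptTriggerH M h c₀ t = c₀e^{M(t²/2 + ht)}`, its ignition time
  `ignitionTimeH = √(h² + 2log(θ/c₀)/M) - h`; `ignitionTimeH_le`, `sub_le_ignitionTimeH` (head start `h`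
  advances ignition by at most `h`); `trigger_le_sweptBound` (any trigger with rate `≤ M(t + h)`),
  `preload_lt_threshold` / `sweptTriggerH_fires_of_ge` (the pre-load tolerance under a timing floor is
  exactly `θe^{-M(t_min²/2 + h t_min)}`), `tolerance_tao_le`, `tolerance_ge_of_le_log`.
* §C `clock_sub_action_antitoneOn`: `b - εΛ` is non-increasing (`Λ' = a²`): head start ≤ ε·(loading
  action).
* §D `drain_residual_le`, `drain_residual_ge`: the two-sided drain window.
* §E `backflow_le`: crude backflow amplification `e^{K(t₁ - t₀)}`.
-/

noncomputable section

open Real Set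

namespace Literature.Analysis.FluidPDE.Tao2016AveragedNS

namespace Handoff

/-! ## A. The O(1) slack in the two places the clock pre-load `h` is consumed -/

/-- **Room in `t_c ≥ 1/2`.** The exponent of the tree's (6.148) bound
(`ZeroScale.Setting.abs_c_zero_le`: `K¹⁰·t·(h + t + K⁻⁷) - K¹⁰/2`, printed `h = 10⁻⁵`) stays below
`-(1/4 - h/2 - r/2)·K¹⁰` on `[0, 1/2]` for ANY head start `h` and error `r` (the tree needs only
`≤ -10K`): the consumption tolerates every `h < 1/2 - O(K⁻⁷)`, not just `10⁻⁵`.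
[cite: Tao2016AveragedNS, §6.7 (6.148), (6.151)] -/
theorem tc_half_exponent_room {K h r t : ℝ} (hK : 0 ≤ K) (hh : 0 ≤ h) (hr : 0 ≤ r)
    (ht : t ∈ Icc (0 : ℝ) (1 / 2)) :
    K ^ 10 * (t * (h + t + r)) - K ^ 10 / 2 ≤ -((1 / 4 - h / 2 - r / 2) * K ^ 10) := by
  have hK10 : 0 ≤ K ^ 10 := pow_nonneg hK 10
  have h1 : t * (h + t + r) ≤ 1 / 2 * (h + 1 / 2 + r) := by
    apply mul_le_mul ht.2 (by linarith [ht.2]) (by linarith [ht.1]) (by norm_num)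
  nlinarith [mul_le_mul_of_nonneg_left h1 hK10]

/-- **Room in `t_c < 2`.** The ignition lower bound `exp((t²/2 - h t - 1 + O(K⁻⁹))K¹⁰)ε²`
(`ZeroScale.Setting.c_zero_lower`, printed `h = 10⁻⁵`) beats `K⁻¹⁰ε²` at `t = 2` as soon as
`2²/2 - 2h - 1 > 0`, i.e. for every head start (here: clock DEFICIT) `h < 1/2`.
[cite: Tao2016AveragedNS, §6.7 (6.158)] -/
theorem tc_two_room {h : ℝ} (hh : h < 1 / 2) : 0 < (2 : ℝ) ^ 2 / 2 - h * 2 - 1 := by nlinarith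

/-! ## B. The head-start swept trigger and the pre-load tolerance under a timing floor -/

/-- **Head-start swept trigger** `c₀·exp(M(t²/2 + h t))`: the amplifier `∂ₜc = ε⁻¹M·b·c` swept by a
clock `b = ε(t + h)` that starts with head start `h` (the pre-load `b_n(t_n)/ε`, in §6 `≤ 10⁻⁵`).
[cite: Tao2016AveragedNS, §6.7 (6.147)–(6.148)] -/
def sweptTriggerH (M h c₀ : ℝ) (t : ℝ) : ℝ := c₀ * Real.exp (M * (t ^ 2 / 2 + h * t))

/-- Without head start this is gen 10's `sweptTrigger`. [cite: Tao2016AveragedNS, §5.5 caricature (i)] -/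
theorem sweptTriggerH_zero (M c₀ : ℝ) : sweptTriggerH M 0 c₀ = sweptTrigger M c₀ := by
  funext t; simp [sweptTriggerH, sweptTrigger, mul_div_assoc]

/-- The primitive `S(t) = M(t²/2 + h t)` of the swept rate `M(t + h)`. [folklore] -/
theorem hasDerivAt_sweptPhase (M h t : ℝ) :
    HasDerivAt (fun s : ℝ => M * (s ^ 2 / 2 + h * s)) (M * (t + h)) t := by
  have h1 : HasDerivAt (fun s : ℝ => s ^ 2 / 2) (↑2 * t ^ (2 - 1) / 2) t :=
    (hasDerivAt_pow 2 t).div_const 2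
  have h2 : HasDerivAt (fun s : ℝ => h * s) (h * 1) t := (hasDerivAt_id' t).const_mul h
  refine ((h1.add h2).const_mul M).congr_deriv ?_
  norm_num

/-- The head-start swept trigger solves `c' = M(t + h)·c`. [cite: Tao2016AveragedNS, §6.7 (6.148)] -/
theorem hasDerivAt_sweptTriggerH (M h c₀ t : ℝ) :
    HasDerivAt (sweptTriggerH M h c₀) (M * (t + h) * sweptTriggerH M h c₀ t) t := by
  have h2 := ((hasDerivAt_sweptPhase M h t).exp).const_mul c₀
  refine h2.congr_deriv ?_
  simp only [sweptTriggerH]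
  ring

/-- The head-start swept trigger is positive for a positive seed. [folklore] -/
theorem sweptTriggerH_pos {M h c₀ : ℝ} (hc : 0 < c₀) (t : ℝ) : 0 < sweptTriggerH M h c₀ t :=
  mul_pos hc (Real.exp_pos _)

/-- **Head-start ignition time** from seed `c₀` to threshold `θ`: `√(h² + 2log(θ/c₀)/M) - h`.
[cite: Tao2016AveragedNS, §6.7 (the time t_c)] -/
def ignitionTimeH (M h c₀ θ : ℝ) : ℝ := Real.sqrt (h ^ 2 + 2 * Real.log (θ / c₀) / M) - h

/-- Without head start this is gen 10's `ignitionTime`. [cite: Tao2016AveragedNS, §5.5 caricature (ii)] -/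
theorem ignitionTimeH_zero (M c₀ θ : ℝ) : ignitionTimeH M 0 c₀ θ = ignitionTime M c₀ θ := by
  simp [ignitionTimeH, ignitionTime]

/-- The head-start ignition time is nonnegative (for `h ≥ 0`, `c₀ ≤ θ`). [folklore] -/
theorem ignitionTimeH_nonneg {M h c₀ θ : ℝ} (hM : 0 < M) (hh : 0 ≤ h) (hc : 0 < c₀) (hcθ : c₀ ≤ θ) :
    0 ≤ ignitionTimeH M h c₀ θ := by
  unfold ignitionTimeH
  have hlog : 0 ≤ Real.log (θ / c₀) := Real.log_nonneg ((one_le_div hc).2 hcθ)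
  have hX : 0 ≤ 2 * Real.log (θ / c₀) / M := by positivity
  have : h ≤ Real.sqrt (h ^ 2 + 2 * Real.log (θ / c₀) / M) := by
    calc h = Real.sqrt (h ^ 2) := (Real.sqrt_sq hh).symm
      _ ≤ _ := Real.sqrt_le_sqrt (by linarith)
  linarith

/-- At the head-start ignition time the trigger is exactly at threshold.
[cite: Tao2016AveragedNS, §6.7 (6.159)] -/
theorem sweptTriggerH_ignitionTimeH {M h c₀ θ : ℝ} (hM : 0 < M) (hc : 0 < c₀) (hcθ : c₀ ≤ θ) :
    sweptTriggerH M h c₀ (ignitionTimeH M h c₀ θ) = θ := by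
  have hθ : 0 < θ := hc.trans_le hcθ
  have hlog : 0 ≤ Real.log (θ / c₀) := Real.log_nonneg ((one_le_div hc).2 hcθ)
  set X := 2 * Real.log (θ / c₀) / M with hXdef
  have hX : 0 ≤ X := by positivity
  set r := Real.sqrt (h ^ 2 + X) with hrdef
  have hr : r ^ 2 = h ^ 2 + X := Real.sq_sqrt (by positivity)
  unfold sweptTriggerH ignitionTimeH
  rw [← hXdef, ← hrdef]
  have hphase : M * ((r - h) ^ 2 / 2 + h * (r - h)) = Real.log (θ / c₀) := by
    have : (r - h) ^ 2 / 2 + h * (r - h) = X / 2 := by nlinarith [hr]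
    rw [this, hXdef]
    field_simp
  rw [hphase, Real.exp_log (div_pos hθ hc)]
  field_simp

/-- **A head start never delays ignition**: `ignitionTimeH M h ≤ ignitionTime M` for `h ≥ 0`.
[cite: Tao2016AveragedNS, §6.7 (6.158)] -/
theorem ignitionTimeH_le {M h c₀ θ : ℝ} (hM : 0 < M) (hh : 0 ≤ h) (hc : 0 < c₀) (hcθ : c₀ ≤ θ) :
    ignitionTimeH M h c₀ θ ≤ ignitionTime M c₀ θ := by
  unfold ignitionTimeH ignitionTime
  have hlog : 0 ≤ Real.log (θ / c₀) := Real.log_nonneg ((one_le_div hc).2 hcθ)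
  set X := 2 * Real.log (θ / c₀) / M with hXdef
  have hX : 0 ≤ X := by positivity
  have hsX : 0 ≤ Real.sqrt X := Real.sqrt_nonneg X
  have h1 : h ^ 2 + X ≤ (h + Real.sqrt X) ^ 2 := by
    nlinarith [Real.sq_sqrt hX, mul_nonneg hh hsX]
  have h2 : Real.sqrt (h ^ 2 + X) ≤ h + Real.sqrt X := by
    calc Real.sqrt (h ^ 2 + X) ≤ Real.sqrt ((h + Real.sqrt X) ^ 2) := Real.sqrt_le_sqrt h1
      _ = h + Real.sqrt X := Real.sqrt_sq (by positivity)
  linarith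

/-- **… and advances it by at most the head start**: `ignitionTime M - h ≤ ignitionTimeH M h`. With
`ignitionTimeH_le`: the clock channel re-times an armed gate by at most its own pre-load `h`, at EVERY
amplifier strength `M` — the O(1) slack of ledger line (L1). [cite: Tao2016AveragedNS, §6.7 (6.151)] -/
theorem sub_le_ignitionTimeH (M h c₀ θ : ℝ) :
    ignitionTime M c₀ θ - h ≤ ignitionTimeH M h c₀ θ := by
  unfold ignitionTimeH ignitionTime
  have : Real.sqrt (2 * Real.log (θ / c₀) / M) ≤ Real.sqrt (h ^ 2 + 2 * Real.log (θ / c₀) / M) :=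
    Real.sqrt_le_sqrt (by nlinarith)
  linarith

/-- **Comparison with the swept bound.** A positive solution of the linear trigger equation
`y' = ρ(t)·y` whose rate obeys `ρ(s) ≤ M(s + h)` on `[0, t₁]` (amplifier driven by a clock that is at
most `ε(s + h)`: (6.147)) satisfies `y(t) ≤ y(0)·exp(M(t²/2 + h t))` on `[0, t₁]` — the caricature of
the tree's Grönwall step (6.148) (which uses the cruder exponent `M·t·(h + t)`).
[cite: Tao2016AveragedNS, §6.7 (6.148)] -/
theorem trigger_le_sweptBound {y ρ : ℝ → ℝ} {M h t₁ t : ℝ}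
    (hy : ∀ t, HasDerivAt y (ρ t * y t) t) (hpos : ∀ t, 0 < y t)
    (hρ : ∀ s ∈ Icc 0 t₁, ρ s ≤ M * (s + h)) (ht : t ∈ Icc 0 t₁) :
    y t ≤ y 0 * Real.exp (M * (t ^ 2 / 2 + h * t)) := by
  have hlog : ∀ s, HasDerivAt (fun u => Real.log (y u)) (ρ s) s := by
    intro s
    refine ((hy s).log (hpos s).ne').congr_deriv ?_
    field_simp [(hpos s).ne']
  have hanti := Thm53.antitoneOn_sub_of_deriv_le (convex_Icc 0 t₁) (fun s _ => hlog s)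
    (fun s _ => hasDerivAt_sweptPhase M h s) hρ
  have h0 : (0 : ℝ) ∈ Icc 0 t₁ := ⟨le_rfl, ht.1.trans ht.2⟩
  have hmon := hanti h0 ht ht.1
  simp only at hmon
  have h' : Real.log (y t) ≤ Real.log (y 0) + M * (t ^ 2 / 2 + h * t) := by
    norm_num at hmon; linarith
  calc y t = Real.exp (Real.log (y t)) := (Real.exp_log (hpos _)).symm
    _ ≤ Real.exp (Real.log (y 0) + M * (t ^ 2 / 2 + h * t)) := Real.exp_le_exp.2 h'
    _ = y 0 * Real.exp (M * (t ^ 2 / 2 + h * t)) := by rw [Real.exp_add, Real.exp_log (hpos _)]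

/-- **Pre-load tolerance under a timing floor (sufficiency).** If the rate obeys `ρ(s) ≤ M(s + h)` on
`[0, t_min]` (`M, h ≥ 0`) and the trigger's initial value is below
`θ·exp(-M(t_min²/2 + h·t_min))`, then it stays strictly below the threshold `θ` on `[0, t_min]`: the
gate does not fire before the floor `t_min`. This is the shape of the tree's `smallC_of_le_half`
(`θ = K⁻¹⁰ε²·O(1)`, `M = K¹⁰`, `t_min = 1/2`, `h = 10⁻⁵ + K⁻⁷`).
[cite: Tao2016AveragedNS, §6.7 (6.148), (6.151)] -/
theorem preload_lt_threshold {y ρ : ℝ → ℝ} {M h θ t_min t : ℝ} (hM : 0 ≤ M) (hh : 0 ≤ h)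
    (hy : ∀ t, HasDerivAt y (ρ t * y t) t) (hpos : ∀ t, 0 < y t)
    (hρ : ∀ s ∈ Icc 0 t_min, ρ s ≤ M * (s + h))
    (h0 : y 0 < θ * Real.exp (-(M * (t_min ^ 2 / 2 + h * t_min)))) (ht : t ∈ Icc 0 t_min) :
    y t < θ := by
  have h1 := trigger_le_sweptBound hy hpos hρ ht
  have hmono : M * (t ^ 2 / 2 + h * t) ≤ M * (t_min ^ 2 / 2 + h * t_min) := by
    apply mul_le_mul_of_nonneg_left _ hM
    nlinarith [ht.1, ht.2, mul_le_mul_of_nonneg_left ht.2 hh]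
  have hE : 0 < Real.exp (M * (t ^ 2 / 2 + h * t)) := Real.exp_pos _
  calc y t ≤ y 0 * Real.exp (M * (t ^ 2 / 2 + h * t)) := h1
    _ < θ * Real.exp (-(M * (t_min ^ 2 / 2 + h * t_min))) * Real.exp (M * (t ^ 2 / 2 + h * t)) :=
        mul_lt_mul_of_pos_right h0 hE
    _ = θ * Real.exp (M * (t ^ 2 / 2 + h * t) - M * (t_min ^ 2 / 2 + h * t_min)) := by
        rw [mul_assoc, ← Real.exp_add]; ring_nf
    _ ≤ θ * Real.exp 0 := by
        have hθ : 0 < θ := (mul_pos_iff_of_pos_right (Real.exp_pos _)).1 ((hpos 0).trans h0)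
        exact mul_le_mul_of_nonneg_left (Real.exp_le_exp.2 (by linarith)) hθ.le
    _ = θ := by simp

/-- **Pre-load tolerance under a timing floor (sharpness).** For the exact head-start swept trigger the
tolerance is attained: from any initial value `c₀ ≥ θ·exp(-M(t_min²/2 + h·t_min))` it IS at threshold by
the floor `t_min`. So the pre-load a checkpoint can accept is exactly `θe^{-M(t_min²/2 + h t_min)}`:
exponentially small iff `M·t_min²` is large — for Tao `M = K¹⁰`, `t_min = 1/2`.
[cite: Tao2016AveragedNS, §6.7 (6.148)] -/
theorem sweptTriggerH_fires_of_ge {M h c₀ θ t_min : ℝ}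
    (h0 : θ * Real.exp (-(M * (t_min ^ 2 / 2 + h * t_min))) ≤ c₀) :
    θ ≤ sweptTriggerH M h c₀ t_min := by
  unfold sweptTriggerH
  have hE : 0 < Real.exp (M * (t_min ^ 2 / 2 + h * t_min)) := Real.exp_pos _
  calc θ = θ * Real.exp (-(M * (t_min ^ 2 / 2 + h * t_min))) *
        Real.exp (M * (t_min ^ 2 / 2 + h * t_min)) := by
          rw [mul_assoc, ← Real.exp_add]; simp
    _ ≤ c₀ * Real.exp (M * (t_min ^ 2 / 2 + h * t_min)) := mul_le_mul_of_nonneg_right h0 hE.le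

/-- **Tao's instance.** With `M = K¹⁰` and floor `t_min = 1/2` the tolerance is at most `θe^{-K¹⁰/8}`
whatever the head start `h ≥ 0`: exponentially small, because and only because the amplifier rate
multiplies an O(1) floor. [cite: Tao2016AveragedNS, §6.7 (6.151)] -/
theorem tolerance_tao_le {K h θ : ℝ} (hθ : 0 ≤ θ) (hh : 0 ≤ h) (hK : 0 ≤ K) :
    θ * Real.exp (-(K ^ 10 * ((1 / 2 : ℝ) ^ 2 / 2 + h * (1 / 2)))) ≤ θ * Real.exp (-(K ^ 10 / 8)) := by
  apply mul_le_mul_of_nonneg_left (Real.exp_le_exp.2 _) hθ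
  have : 0 ≤ K ^ 10 * h := mul_nonneg (pow_nonneg hK 10) hh
  nlinarith

/-- **The polynomial instance.** If the design keeps `M(t_min²/2 + h·t_min) ≤ p·log K` (amplifier rate
times squared floor logarithmic — equivalently, by gen 10's sharpening law, arming depth `O(log K)`),
the tolerance is at least `θK⁻ᵖ`: polynomial. [cite: Tao2016AveragedNS, §6.7 (6.151)] -/
theorem tolerance_ge_of_le_log {K M h θ t_min p : ℝ} (hθ : 0 ≤ θ) (hK : 0 < K)
    (hlog : M * (t_min ^ 2 / 2 + h * t_min) ≤ p * Real.log K) :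
    θ * K ^ (-p) ≤ θ * Real.exp (-(M * (t_min ^ 2 / 2 + h * t_min))) := by
  apply mul_le_mul_of_nonneg_left _ hθ
  rw [Real.rpow_def_of_pos hK]
  exact Real.exp_le_exp.2 (by nlinarith)

/-! ## C. The next clock's head start IS the loading action -/

/-- **Head start = ε × loading action.** Along any trajectory on which the new clock obeys Tao's
`b' = ε a² - (M/ε) c²` ((6.46) rescaled, `M = K¹⁰`) and `Λ' = a²` (the loading action `Λ = ∫a₁²`,
(6.21)/(6.23): `≤ K^{-1/4}` in §6), the function `b - εΛ` is non-increasing: the clock pre-load handed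
to the next checkpoint is at most `ε·Λ`. Ledger (L1) in reverse: what is PRODUCED is `h ≤ Λ`.
[cite: Tao2016AveragedNS, §6.4 (6.46), §6.2 (6.21)] -/
theorem clock_sub_action_antitoneOn {b Λ a c : ℝ → ℝ} {ε M t₀ t₁ : ℝ} (hε : 0 < ε) (hM : 0 ≤ M)
    (hb : ∀ t, HasDerivAt b (ε * a t ^ 2 - M / ε * c t ^ 2) t)
    (hΛ : ∀ t, HasDerivAt Λ (a t ^ 2) t) :
    AntitoneOn (fun t => b t - ε * Λ t) (Icc t₀ t₁) := by
  have hΦ : ∀ t ∈ Icc t₀ t₁, HasDerivAt (fun s => ε * Λ s) (ε * a t ^ 2) t :=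
    fun t _ => (hΛ t).const_mul ε
  refine Thm53.antitoneOn_sub_of_deriv_le (convex_Icc t₀ t₁) (fun t _ => hb t) hΦ ?_
  intro t _
  have : 0 ≤ M / ε * c t ^ 2 := by positivity
  linarith

/-- Corollary: `b(t₁) - b(t₀) ≤ ε(Λ(t₁) - Λ(t₀))`. [cite: Tao2016AveragedNS, §6.4 (6.46)] -/
theorem clock_gain_le_action {b Λ a c : ℝ → ℝ} {ε M t₀ t₁ : ℝ} (hε : 0 < ε) (hM : 0 ≤ M)
    (ht : t₀ ≤ t₁) (hb : ∀ t, HasDerivAt b (ε * a t ^ 2 - M / ε * c t ^ 2) t)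
    (hΛ : ∀ t, HasDerivAt Λ (a t ^ 2) t) :
    b t₁ - b t₀ ≤ ε * (Λ t₁ - Λ t₀) := by
  have h := clock_sub_action_antitoneOn (t₀ := t₀) (t₁ := t₁) hε hM hb hΛ ⟨le_rfl, ht⟩ ⟨ht, le_rfl⟩ ht
  simp only at h
  linarith

/-! ## D. The drain window is two-sided -/

/-- **Drain completeness (upper bound on the residual).** If the old level's energy `E ≥ 0` obeys
`E' ≤ -K·a₁·E + r` on `[t₀, t₁]` (Tao's equipartition form of the drain, (6.183)–(6.185): the pump
`K d₀² a₁` drains `½(a₀² + d₀²)` at rate `K a₁` up to the corrector `r`) and the catalyst satisfies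
`a₁ ≥ α > 0` there (§6.7: `a₁ ≥ 0.05` on `[t_c + 1/K, τ₁]`), then
`E(t₁) ≤ r/(Kα) + (E(t₀) - r/(Kα))·e^{-Kα(t₁ - t₀)}`: the residual handed over (ledger (L4),
`≤ K⁻²⁰`) costs `KαW ≳ 20 log K` e-folds of window `W = t₁ - t₀` — polynomial.
[cite: Tao2016AveragedNS, §6.7 (6.185)] -/
theorem drain_residual_le {E E' a : ℝ → ℝ} {K α r t₀ t₁ : ℝ} (hK : 0 < K) (hα : 0 < α)
    (ht : t₀ ≤ t₁) (hE : ∀ t, HasDerivAt E (E' t) t) (hE0 : ∀ t ∈ Icc t₀ t₁, 0 ≤ E t)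
    (ha : ∀ t ∈ Icc t₀ t₁, α ≤ a t) (hineq : ∀ t ∈ Icc t₀ t₁, E' t ≤ -K * a t * E t + r) :
    E t₁ ≤ r / (K * α) + (E t₀ - r / (K * α)) * Real.exp (-(K * α * (t₁ - t₀))) := by
  set κ := K * α with hκ
  have hκ0 : 0 < κ := mul_pos hK hα
  -- integrating factor `e^{κt}`: `G = -κt`, `g = -κ`; `φ = r e^{κt}`, `Φ = (r/κ) e^{κt}`
  have hG : ∀ t ∈ Icc t₀ t₁, HasDerivAt (fun s : ℝ => -κ * s) (-κ) t := fun t _ => by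
    simpa using (hasDerivAt_id' t).const_mul (-κ)
  have hΦ : ∀ t ∈ Icc t₀ t₁, HasDerivAt (fun s : ℝ => r / κ * Real.exp (κ * s)) (r * Real.exp (κ * t)) t := by
    intro t _
    have h1 : HasDerivAt (fun s : ℝ => κ * s) (κ * 1) t := (hasDerivAt_id' t).const_mul κ
    have h2 := (h1.exp).const_mul (r / κ)
    refine h2.congr_deriv ?_
    field_simp
  have hcond : ∀ t ∈ Icc t₀ t₁,
      (E' t - -κ * E t) * Real.exp (-(-κ * t)) ≤ r * Real.exp (κ * t) := by
    intro t htI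
    have h1 : κ * E t ≤ K * a t * E t := by
      rw [hκ]
      have := mul_le_mul_of_nonneg_left (ha t htI) hK.le
      exact mul_le_mul_of_nonneg_right this (hE0 t htI)
    have h2 : E' t - -κ * E t ≤ r := by linarith [hineq t htI]
    have : Real.exp (-(-κ * t)) = Real.exp (κ * t) := by ring_nf
    rw [this]
    exact mul_le_mul_of_nonneg_right h2 (Real.exp_pos _).le
  have hanti := Thm53.antitoneOn_intFactor (convex_Icc t₀ t₁) (fun t _ => hE t) hG hΦ hcond
  have h := hanti ⟨le_rfl, ht⟩ ⟨ht, le_rfl⟩ ht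
  simp only at h
  have e1 : Real.exp (-(-κ * t₁)) = Real.exp (κ * t₁) := by ring_nf
  have e0 : Real.exp (-(-κ * t₀)) = Real.exp (κ * t₀) := by ring_nf
  rw [e1, e0] at h
  -- `h : E t₁ e₁ - (r/κ) e₁ ≤ E t₀ e₀ - (r/κ) e₀`
  have hsplit : Real.exp (κ * t₀) = Real.exp (-(κ * (t₁ - t₀))) * Real.exp (κ * t₁) := by
    rw [← Real.exp_add]; ring_nf
  have key : (E t₁ - r / κ) * Real.exp (κ * t₁) ≤
      ((E t₀ - r / κ) * Real.exp (-(κ * (t₁ - t₀)))) * Real.exp (κ * t₁) := by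
    have lhs : (E t₁ - r / κ) * Real.exp (κ * t₁) = E t₁ * Real.exp (κ * t₁) - r / κ * Real.exp (κ * t₁) := by ring
    have rhs : ((E t₀ - r / κ) * Real.exp (-(κ * (t₁ - t₀)))) * Real.exp (κ * t₁) =
        E t₀ * Real.exp (κ * t₀) - r / κ * Real.exp (κ * t₀) := by rw [hsplit]; ring
    rw [lhs, rhs]; exact h
  have := le_of_mul_le_mul_right key (Real.exp_pos _)
  linarith

/-- **Drain floor (lower bound on the residual).** If `E ≥ 0` obeys `E' ≥ -K·a₁·E` on `[t₀, t₁]`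
(nothing drains faster than the pump) and the catalyst is at most `ᾱ` (`a₁² ≤` the energy, so `ᾱ ≤ 1+`),
then `E(t₁) ≥ E(t₀)·e^{-Kᾱ(t₁ - t₀)}`: reaching residual `K^{-q}` from `E(t₀) ≍ 1` needs a window
`W ≥ q·log K/(Kᾱ)`. Together with `drain_residual_le`: the hand-off window is pinned between
`q log K/(Kᾱ)` and whatever the loading-action budget allows — both polynomial; Tao's `K^{-1/2}` sits
comfortably inside for `K ≥ 10¹⁸`. [cite: Tao2016AveragedNS, §6.7 (6.183)] -/
theorem drain_residual_ge {E E' a : ℝ → ℝ} {K abar t₀ t₁ : ℝ} (hK : 0 ≤ K)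
    (ht : t₀ ≤ t₁) (hE : ∀ t, HasDerivAt E (E' t) t) (hE0 : ∀ t ∈ Icc t₀ t₁, 0 ≤ E t)
    (ha : ∀ t ∈ Icc t₀ t₁, a t ≤ abar) (hineq : ∀ t ∈ Icc t₀ t₁, -K * a t * E t ≤ E' t) :
    E t₀ * Real.exp (-(K * abar * (t₁ - t₀))) ≤ E t₁ := by
  set κ := K * abar with hκ
  -- integrating factor on `-E`: `(-E)' = -E' ≤ K a E ≤ κ E = -κ(-E)`, growth rate `-κ`
  have hG : ∀ t ∈ Icc t₀ t₁, HasDerivAt (fun s : ℝ => -κ * s) (-κ) t := fun t _ => by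
    simpa using (hasDerivAt_id' t).const_mul (-κ)
  have hΦ : ∀ t ∈ Icc t₀ t₁, HasDerivAt (fun _ : ℝ => (0 : ℝ)) 0 t := fun t _ => hasDerivAt_const t 0
  have hnegE : ∀ t ∈ Icc t₀ t₁, HasDerivAt (fun s => -E s) (-E' t) t := fun t _ => (hE t).neg
  have hcond : ∀ t ∈ Icc t₀ t₁, (-E' t - -κ * -E t) * Real.exp (-(-κ * t)) ≤ 0 := by
    intro t htI
    have h1 : K * a t * E t ≤ κ * E t := by
      rw [hκ]
      exact mul_le_mul_of_nonneg_right (mul_le_mul_of_nonneg_left (ha t htI) hK) (hE0 t htI)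
    have h2 : -E' t - -κ * -E t ≤ 0 := by linarith [hineq t htI]
    exact mul_nonpos_of_nonpos_of_nonneg h2 (Real.exp_pos _).le
  have hanti := Thm53.antitoneOn_intFactor (convex_Icc t₀ t₁) hnegE hG hΦ hcond
  have h := hanti ⟨le_rfl, ht⟩ ⟨ht, le_rfl⟩ ht
  simp only [sub_zero] at h
  have e1 : Real.exp (-(-κ * t₁)) = Real.exp (κ * t₁) := by ring_nf
  have e0 : Real.exp (-(-κ * t₀)) = Real.exp (κ * t₀) := by ring_nf
  rw [e1, e0] at h
  -- `h : -E t₁ e₁ ≤ -E t₀ e₀`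
  have hsplit : Real.exp (κ * t₀) = Real.exp (-(κ * (t₁ - t₀))) * Real.exp (κ * t₁) := by
    rw [← Real.exp_add]; ring_nf
  have key : (E t₀ * Real.exp (-(κ * (t₁ - t₀)))) * Real.exp (κ * t₁) ≤ E t₁ * Real.exp (κ * t₁) := by
    rw [mul_assoc, ← hsplit]; linarith
  exact le_of_mul_le_mul_right key (Real.exp_pos _)

/-! ## E. Backflow: the crude bound, and why Prop. 6.17 exists -/

/-- **Crude backflow bound.** If the older level's energy `E ≥ 0` obeys `E' ≤ K·|a₀|·E + r` on
`[t₀, t₁]` (the back-pump `K d₋₁² a₀` when `a₀ < 0`, (6.168)) with `|a₀| ≤ 1`, then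
`E(t₁) + r/K ≤ (E(t₀) + r/K)·e^{K(t₁ - t₀)}`. Over Tao's rotor window `t₁ - t₀ = K^{-1/2}` the factor is
`e^{√K}`: affordable only against a pre-decay of the residual over the (longer) delay, which is how
Prop. 6.17 pays for it (equipartition form `exp(-(K/2)∫a₀)`, ledger (L5)); over a drain-limited window
`q log K/(Kᾱ)` it is the polynomial `K^{q/ᾱ}` outright.
[cite: Tao2016AveragedNS, §6.7 Prop. 6.17 (6.168)] -/
theorem backflow_le {E E' a : ℝ → ℝ} {K r t₀ t₁ : ℝ} (hK : 0 < K)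
    (ht : t₀ ≤ t₁) (hE : ∀ t, HasDerivAt E (E' t) t) (hE0 : ∀ t ∈ Icc t₀ t₁, 0 ≤ E t)
    (ha : ∀ t ∈ Icc t₀ t₁, |a t| ≤ 1) (hineq : ∀ t ∈ Icc t₀ t₁, E' t ≤ K * |a t| * E t + r) :
    E t₁ + r / K ≤ (E t₀ + r / K) * Real.exp (K * (t₁ - t₀)) := by
  -- integrating factor `e^{-Kt}`: `G = Kt`, `g = K`; `φ = r e^{-Kt}`, `Φ = -(r/K) e^{-Kt}`
  have hG : ∀ t ∈ Icc t₀ t₁, HasDerivAt (fun s : ℝ => K * s) K t := fun t _ => by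
    simpa using (hasDerivAt_id' t).const_mul K
  have hΦ : ∀ t ∈ Icc t₀ t₁,
      HasDerivAt (fun s : ℝ => -(r / K) * Real.exp (-(K * s))) (r * Real.exp (-(K * t))) t := by
    intro t _
    have h1 : HasDerivAt (fun s : ℝ => -(K * s)) (-(K * 1)) t := ((hasDerivAt_id' t).const_mul K).neg
    have h2 := (h1.exp).const_mul (-(r / K))
    refine h2.congr_deriv ?_
    field_simp
  have hcond : ∀ t ∈ Icc t₀ t₁,
      (E' t - K * E t) * Real.exp (-(K * t)) ≤ r * Real.exp (-(K * t)) := by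
    intro t htI
    have h1 : K * |a t| * E t ≤ K * E t := by
      have := mul_le_mul_of_nonneg_left (ha t htI) hK.le
      have := mul_le_mul_of_nonneg_right this (hE0 t htI)
      simpa using this
    have h2 : E' t - K * E t ≤ r := by linarith [hineq t htI]
    exact mul_le_mul_of_nonneg_right h2 (Real.exp_pos _).le
  have hanti := Thm53.antitoneOn_intFactor (convex_Icc t₀ t₁) (fun t _ => hE t) hG hΦ hcond
  have h := hanti ⟨le_rfl, ht⟩ ⟨ht, le_rfl⟩ ht
  simp only at h
  -- `h : E t₁ e^{-Kt₁} + (r/K) e^{-Kt₁} ≤ E t₀ e^{-Kt₀} + (r/K) e^{-Kt₀}`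
  have hsplit : Real.exp (-(K * t₀)) = Real.exp (K * (t₁ - t₀)) * Real.exp (-(K * t₁)) := by
    rw [← Real.exp_add]; ring_nf
  have key : (E t₁ + r / K) * Real.exp (-(K * t₁)) ≤
      ((E t₀ + r / K) * Real.exp (K * (t₁ - t₀))) * Real.exp (-(K * t₁)) := by
    have lhs : (E t₁ + r / K) * Real.exp (-(K * t₁)) =
        E t₁ * Real.exp (-(K * t₁)) - -(r / K) * Real.exp (-(K * t₁)) := by ring
    have rhs : ((E t₀ + r / K) * Real.exp (K * (t₁ - t₀))) * Real.exp (-(K * t₁)) =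
        E t₀ * Real.exp (-(K * t₀)) - -(r / K) * Real.exp (-(K * t₀)) := by rw [hsplit]; ring
    rw [lhs, rhs]; exact h
  exact le_of_mul_le_mul_right key (Real.exp_pos _)

end Handoff

end Literature.Analysis.FluidPDE.Tao2016AveragedNS
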